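import Literature.MathematicalPhysics.QuantumLattice.HubbardNNNHoppingThermodynamicLimit
import HarnessLib

/-!
# Particle–hole symmetry of the ground-state energy density of the `t–t'` Hubbard model

Family `hubbard` (topic `MathematicalPhysics/QuantumLattice`). On every even torus the particle–hole
transformation `c_{xσ} ↦ (-1)^{x₁+x₂} c†_{xσ}` maps the `t–t'` Hubbard Hamiltonian `H(t, t', U)`
(LeBlanc et al. (2015) eq. (1), Xu et al. (2024) eq. (1)) to `H(t, -t', U) - U N̂ + U|Λ|`, whence the
sector identity `E_{t,t',U}(N) = E_{t,-t',U}(2|Λ| - N) - (|Λ| - N) U` (in the tree: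
`groundEnergy_hubbardRectTorusTT'_particleHole'`, `HubbardNNNHoppingRectSymmetries.lean`; Lieb–Wu,
Physica A 321 (2003) 1, §1 eq. (3); Essler et al. (2005) §2.2.4). Dividing by the volume and passing
to the thermodynamic limit along the even tori (`tendsto_energyDensityTT'`, Ruelle (1969) §3.3 — the
rounding `N_L(n) = 2⌊nL²/2⌋` of the two densities differs by at most three particles, absorbed by the
volume-uniform one-particle addition cost `groundEnergy_hubbardRectTorusTT'_square_add_le`) gives the
**particle–hole symmetry of the energy density**

  `e(t, t', U, n) = e(t, -t', U, 2 - n) + U (n - 1)`,   `0 < n < 2`, `U ≥ 0`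

(`energyDensityTT'_particleHole`): hole doping `δ = 1 - n` at diagonal hopping `t'` is electron
doping `δ` at `-t'` up to the explicit linear term — the dictionary behind "`t' = -0.2` for hole
doping and `t' = +0.2` for electron doping" (Xu et al. (2024) p. 2). Corollaries: at half filling the
density is even in `t'` (`energyDensityTT'_particleHole_one`), and at `t' = 0` the tree's
`energyDensity2D` satisfies `e(n) = e(2 - n) + U (n - 1)` (`energyDensity2D_particleHole`).
Everything is proved; no definitions.

## References

* E. H. Lieb, F. Y. Wu, *The one-dimensional Hubbard model: a reminiscence*, Physica A 321 (2003)
  1–27, §1 eq. (3) (particle–hole symmetry of the sector ground-state energies on a bipartite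
  lattice, any dimension). [cite: LiebWuPhysicaA2003, §1 eq. (3)]
* F. H. L. Essler, H. Frahm, F. Göhmann, A. Klümper, V. E. Korepin, *The One-Dimensional Hubbard
  Model* (CUP, 2005), §2.2.4 eqs. (2.59)–(2.61) (the transformation; next-nearest-neighbour hopping
  changes sign). [cite: EsslerEtAl2005, §2.2.4]
* D. Ruelle, *Statistical Mechanics: Rigorous Results* (Benjamin, 1969), §3.3–§3.4 (thermodynamic
  limit of the ground-state energy density; continuity in the density). [cite: Ruelle1969, §3.3]
* H. Xu et al., Science 384 (2024) eadh7691, eq. (1) and p. 2 (the `t–t'` model; `t' = ∓0.2` for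
  hole/electron doping). [cite: XuEtAl2024, eq. (1)]
-/

noncomputable section

open Matrix Finset Filter Topology
open scoped ComplexOrder BigOperators

namespace Literature.MathematicalPhysics.QuantumLattice

namespace ThermodynamicLimit

/-! ### The two roundings `N_L(n)` and `N_L(2 - n)` fill the torus up to at most three particles -/

/-- `N_L(n) + N_L(2 - n) ≤ 2L²`: the rounded particle numbers at densities `n` and `2 - n` never
overfill the `L × L` torus (`N_L(m) ≤ m L²`). [cite: Ruelle1969, §3.3] -/
theorem rectN_add_rectN_two_sub_le {n : ℝ} (hn0 : 0 ≤ n) (hn2 : n ≤ 2) (L : ℕ) :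
    rectN n L + rectN (2 - n) L ≤ 2 * (L * L) := by
  have h1 := rectN_le hn0 L
  have h2 := rectN_le (by linarith : 0 ≤ 2 - n) L
  have h : ((rectN n L + rectN (2 - n) L : ℕ) : ℝ) ≤ (2 * (L * L) : ℕ) := by
    push_cast
    nlinarith
  exact_mod_cast h

/-- `2L² - N_L(2 - n) - N_L(n) ≤ 3`: the complementary roundings miss at most three particles
(`m L² < N_L(m) + 2` for both densities). [cite: Ruelle1969, §3.3] -/
theorem two_mul_sub_rectN_sub_rectN_le_three (n : ℝ) (L : ℕ) :
    2 * (L * L) - rectN (2 - n) L - rectN n L ≤ 3 := by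
  have h1 := lt_rectN_add_two n L
  have h2 := lt_rectN_add_two (2 - n) L
  have h : ((2 * (L * L) : ℕ) : ℝ) < rectN (2 - n) L + rectN n L + 4 := by
    push_cast
    nlinarith
  have h' : 2 * (L * L) < rectN (2 - n) L + rectN n L + 4 := by exact_mod_cast h
  omega

/-! ### The finite-volume comparison on even tori -/

/-- **Finite-volume particle–hole comparison with rounding.** On the even torus `L × L` with
`(2 - n) L² ≥ 4` (`0 ≤ n < 2`), the `N_L(2-n)`-particle ground-state energy at diagonal hopping
`-t'` is at most the `N_L(n)`-particle one at `t'` plus three one-particle addition costs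
`A = 36(2|t| + |U| + 2|t'|)/(2 - m)`, `m = (n + 2)/2`, minus the particle–hole constant:
`E_{t,-t',U}(N_L(2-n)) ≤ E_{t,t',U}(N_L(n)) + 3A - (L² - N_L(2-n)) U`
(`E_{t,-t'}(N') = E_{t,t'}(2L² - N') - (L² - N')U` and `2L² - N' = N_L(n) + d`, `d ≤ 3`).
[cite: LiebWuPhysicaA2003, §1 eq. (3)] -/
theorem groundEnergy_rectN_two_sub_le {L : ℕ} (hL : Even L) (t t' U : ℝ) {n : ℝ} (hn0 : 0 ≤ n)
    (hn2 : n < 2) (hLn : 4 ≤ (2 - n) * (L : ℝ) ^ 2) :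
    groundEnergy (hubbardRectTorusTT' L L t (-t') U) (rectN (2 - n) L) ≤
      groundEnergy (hubbardRectTorusTT' L L t t' U) (rectN n L) +
        3 * (36 * (2 * |t| + |U| + 2 * |t'|) / (2 - (n + 2) / 2)) -
        ((L * L : ℕ) - (rectN (2 - n) L : ℝ)) * U := by
  set N := rectN n L with hN
  set N' := rectN (2 - n) L with hN'
  set A : ℝ := 36 * (2 * |t| + |U| + 2 * |t'|) / (2 - (n + 2) / 2) with hA
  have h2n : 0 < 2 - n := by linarith
  have hA0 : 0 ≤ A := by
    have : 0 < 2 - (n + 2) / 2 := by linarith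
    positivity
  -- the two roundings
  have hsum : N + N' ≤ 2 * (L * L) := rectN_add_rectN_two_sub_le hn0 hn2.le L
  have hN'le : N' ≤ 2 * (L * L) := le_trans (Nat.le_add_left _ _) hsum
  set d := 2 * (L * L) - N' - N with hd
  have hd3 : d ≤ 3 := two_mul_sub_rectN_sub_rectN_le_three n L
  have hsplit : 2 * (L * L) - N' = N + d := by omega
  -- particle–hole at hopping `-t'`
  have hPH := groundEnergy_hubbardRectTorusTT'_particleHole' hL hL t (-t') U (N := N') hN'le
  rw [neg_neg, hsplit] at hPH
  -- the addition cost at density `m = (n+2)/2 < 2`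
  have hm : (n + 2) / 2 < 2 := by linarith
  have hNd : ((N + d : ℕ) : ℝ) ≤ (n + 2) / 2 * (L : ℝ) ^ 2 := by
    have e1 : ((N + d : ℕ) : ℝ) = (2 * (L * L) : ℕ) - (N' : ℝ) := by
      rw [← hsplit, Nat.cast_sub hN'le]
    have e2 := lt_rectN_add_two (2 - n) L
    rw [e1]
    push_cast
    nlinarith
  have hadd := groundEnergy_hubbardRectTorusTT'_square_add_le L t t' U hm (N := N) (d := d) hNd
  have hdA : (d : ℝ) * A ≤ 3 * A := by
    have : (d : ℝ) ≤ 3 := by exact_mod_cast hd3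
    exact mul_le_mul_of_nonneg_right this hA0
  rw [hPH]
  have hcard : ((L * L : ℕ) : ℝ) = (L : ℝ) * L := by push_cast; ring
  rw [hcard]
  linarith

/-! ### The thermodynamic limit -/

/-- One-sided particle–hole bound in the thermodynamic limit: for `U ≥ 0` and `0 < n < 2`,
`e(t, -t', U, 2 - n) ≤ e(t, t', U, n) - U (n - 1)` (divide `groundEnergy_rectN_two_sub_le` by `L²`
along the even tori and let `L → ∞`; `N_L(2-n)/L² → 2 - n`). [cite: LiebWuPhysicaA2003, §1 eq. (3)] -/
theorem energyDensityTT'_two_sub_le (t t' : ℝ) {U : ℝ} (hU : 0 ≤ U) {n : ℝ} (hn0 : 0 < n)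
    (hn2 : n < 2) :
    energyDensityTT' t (-t') U (2 - n) ≤ energyDensityTT' t t' U n - U * (n - 1) := by
  set A : ℝ := 36 * (2 * |t| + |U| + 2 * |t'|) / (2 - (n + 2) / 2) with hA
  have hm0 : (0 : ℝ) ≤ 2 - n := by linarith
  have hm2 : 2 - n < 2 := by linarith
  -- the two limits along all `L`
  have hlhs := tendsto_energyDensityTT' t (-t') hU hm0 hm2
  have hrhsE := tendsto_energyDensityTT' t t' hU hn0.le hn2
  have hsq : Tendsto (fun L : ℕ => (L : ℝ) ^ 2) atTop atTop :=
    (tendsto_pow_atTop two_ne_zero).comp tendsto_natCast_atTop_atTop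
  have hA : Tendsto (fun L : ℕ => 3 * A / (L : ℝ) ^ 2) atTop (𝓝 0) :=
    tendsto_const_nhds.div_atTop hsq
  have hdens : Tendsto (fun L : ℕ => (1 - (rectN (2 - n) L : ℝ) / (L : ℝ) ^ 2) * U) atTop
      (𝓝 ((1 - (2 - n)) * U)) :=
    ((tendsto_rectN_div_sq hm0).const_sub 1).mul_const U
  have hrhs : Tendsto (fun L : ℕ =>
      groundEnergy (hubbardRectTorusTT' L L t t' U) (rectN n L) / (L : ℝ) ^ 2 +
        3 * A / (L : ℝ) ^ 2 - (1 - (rectN (2 - n) L : ℝ) / (L : ℝ) ^ 2) * U) atTop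
      (𝓝 (energyDensityTT' t t' U n + 0 - (1 - (2 - n)) * U)) :=
    (hrhsE.add hA).sub hdens
  have hlim : energyDensityTT' t t' U n + 0 - (1 - (2 - n)) * U =
      energyDensityTT' t t' U n - U * (n - 1) := by ring
  rw [hlim] at hrhs
  -- along the even side lengths `L = 2M`
  have hT : Tendsto (fun M : ℕ => 2 * M) atTop atTop :=
    Filter.tendsto_id.const_mul_atTop' (by norm_num)
  refine le_of_tendsto_of_tendsto (hlhs.comp hT) (hrhs.comp hT) ?_
  -- eventually `(2 - n) (2M)² ≥ 4`
  have hev : ∀ᶠ M : ℕ in atTop, 4 ≤ (2 - n) * (((2 * M : ℕ) : ℝ)) ^ 2 := by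
    have h4 : Tendsto (fun M : ℕ => (2 - n) * (((2 * M : ℕ) : ℝ)) ^ 2) atTop atTop :=
      (hsq.comp hT).const_mul_atTop (by linarith)
    exact h4.eventually_ge_atTop 4
  filter_upwards [hev, Filter.eventually_ge_atTop 1] with M hM hM1
  simp only [Function.comp_apply]
  have hLpos : (0 : ℝ) < ((2 * M : ℕ) : ℝ) := by
    have : 1 ≤ 2 * M := by omega
    exact_mod_cast this
  have hL2 : (0 : ℝ) < (((2 * M : ℕ) : ℝ)) ^ 2 := by positivity
  have hfin := groundEnergy_rectN_two_sub_le (L := 2 * M) (even_two_mul M) t t' U hn0.le hn2 hM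
  have hcard : (((2 * M) * (2 * M) : ℕ) : ℝ) = (((2 * M : ℕ) : ℝ)) ^ 2 := by push_cast; ring
  rw [hcard] at hfin
  -- abbreviations
  set S : ℝ := (((2 * M : ℕ) : ℝ)) ^ 2 with hS
  set E₁ := groundEnergy (hubbardRectTorusTT' (2 * M) (2 * M) t (-t') U) (rectN (2 - n) (2 * M))
    with hE₁
  set E₂ := groundEnergy (hubbardRectTorusTT' (2 * M) (2 * M) t t' U) (rectN n (2 * M)) with hE₂
  set N' : ℝ := (rectN (2 - n) (2 * M) : ℝ) with hN'
  have hS0 : S ≠ 0 := hL2.ne'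
  have key : E₂ / S + 3 * A / S - (1 - N' / S) * U - E₁ / S = (E₂ + 3 * A - (S - N') * U - E₁) / S := by
    field_simp
  have hnn : 0 ≤ (E₂ + 3 * A - (S - N') * U - E₁) / S := div_nonneg (by linarith) hL2.le
  linarith

/-- **Particle–hole symmetry of the ground-state energy density of the two-dimensional `t–t'`
Hubbard model.** For `U ≥ 0` and `0 < n < 2`,
`e(t, t', U, n) = e(t, -t', U, 2 - n) + U (n - 1)`: the energy per site at electron density `n` and
diagonal hopping `t'` equals the one at density `2 - n` and hopping `-t'` up to the explicit linear
term (the finite-torus identity `E_{t,t'}(N) = E_{t,-t'}(2|Λ| - N) - (|Λ| - N)U` of Lieb–Wu (2003)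
§1 eq. (3) / Essler et al. (2005) §2.2.4 in the thermodynamic limit of Ruelle (1969) §3.3).
[cite: LiebWuPhysicaA2003, §1 eq. (3)] -/
theorem energyDensityTT'_particleHole (t t' : ℝ) {U : ℝ} (hU : 0 ≤ U) {n : ℝ} (hn0 : 0 < n)
    (hn2 : n < 2) :
    energyDensityTT' t t' U n = energyDensityTT' t (-t') U (2 - n) + U * (n - 1) := by
  have h1 := energyDensityTT'_two_sub_le t t' hU hn0 hn2
  have h2 := energyDensityTT'_two_sub_le t (-t') hU (n := 2 - n) (by linarith) (by linarith)
  rw [neg_neg, show (2 : ℝ) - (2 - n) = n by ring] at h2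
  linarith

/-- The same symmetry read at hopping `-t'`: `e(t, -t', U, n) = e(t, t', U, 2 - n) + U (n - 1)`
(`0 < n < 2`, `U ≥ 0`). [cite: LiebWuPhysicaA2003, §1 eq. (3)] -/
theorem energyDensityTT'_particleHole' (t t' : ℝ) {U : ℝ} (hU : 0 ≤ U) {n : ℝ} (hn0 : 0 < n)
    (hn2 : n < 2) :
    energyDensityTT' t (-t') U n = energyDensityTT' t t' U (2 - n) + U * (n - 1) := by
  have h := energyDensityTT'_particleHole t (-t') hU hn0 hn2
  rwa [neg_neg] at h

/-- **At half filling the energy density is even in the diagonal hopping**: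
`e(t, -t', U, 1) = e(t, t', U, 1)` for `U ≥ 0` (the case `n = 1` of the particle–hole symmetry; on
every even torus already `E_{t,t'}(|Λ|) = E_{t,-t'}(|Λ|)`). [cite: LiebWuPhysicaA2003, §1 eq. (3)] -/
theorem energyDensityTT'_particleHole_one (t t' : ℝ) {U : ℝ} (hU : 0 ≤ U) :
    energyDensityTT' t (-t') U 1 = energyDensityTT' t t' U 1 := by
  have h := energyDensityTT'_particleHole t t' hU (n := 1) one_pos one_lt_two
  rw [show (2 : ℝ) - 1 = 1 by norm_num] at h
  linarith

/-- **Particle–hole symmetry of the energy density of the square-lattice Hubbard model**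
(`t' = 0`): `e(t, U, n) = e(t, U, 2 - n) + U (n - 1)` for `U ≥ 0`, `0 < n < 2`, where
`e = energyDensity2D` (`energyDensityTT'_zero`). Lieb–Wu (2003) §1 eq. (3) in the thermodynamic
limit. [cite: LiebWuPhysicaA2003, §1 eq. (3)] -/
theorem energyDensity2D_particleHole (t : ℝ) {U : ℝ} (hU : 0 ≤ U) {n : ℝ} (hn0 : 0 < n)
    (hn2 : n < 2) :
    energyDensity2D t U n = energyDensity2D t U (2 - n) + U * (n - 1) := by
  have h := energyDensityTT'_particleHole t 0 hU hn0 hn2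
  rwa [neg_zero, energyDensityTT'_zero, energyDensityTT'_zero] at h

end ThermodynamicLimit

end Literature.MathematicalPhysics.QuantumLattice

end
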